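import Literature.Topology.FourManifolds.TrisectionsMiddleRegion
import Literature.Topology.FourManifolds.FlowTimeChange
import Literature.Topology.FourManifolds.FlowFibreMorseData
import HarnessLib

/-!
# The gradient-like frame of a bi-collar: the un-normalised field and its `2`-handle boxes

Topic `Literature/Topology/FourManifolds`; glue for steps F–G of a Morse-theoretic construction of
Gay–Kirby's trisection for the fact seat
`provefact-Literature.Topology.FourManifolds.exists_isBalancedGKTrisection` (Gay–Kirby 2016,
Thm. 4 via §4, Lemma 14).  Everything in this file is **proved**; the one definition is a
structure recording data and hypotheses (no named facts).

The sectors and their faces are built from a bi-collar `B` (`TrisectionsBiCollar.lean`: the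
Morse function `f`, its regular level `Y = f⁻¹(a)` with a **unit-speed** field `U.ξ` across it,
the Heegaard function `g` on `Y`), while the Morse theory inside the `2`-handles is done in
Milnor's charts of a **gradient-like field `ζ` in normal form** (`HandleBoxes f ζ a η ι`,
`TrisectionsHandleBoxes.lean`; Milnor 1965, Def. 3.1).  The two fields cannot coincide — on
`Y ∩ box` the normal form gives `ζ(f) = 2(A + B)`, not `1` — but, as in Milnor's normalisation
(proof of Thm. 3.4), `U.ξ = ρ_U • ζ` is a positive multiple of `ζ`: the two flows have the same
trajectories (`FlowTimeChange.lean`).  This file records that relation as a structure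
`BiCollar.ZFrame` and proves the dictionary used downstream:

* `ZFrame.hit_iff` — hitting the level is the same for both flows;
* `ZFrame.levelProj_eq`, `ZFrame.lam_eq`, `ZFrame.incl_lamLift_eq` — the projection onto the
  level agrees **everywhere** (at hitting points by `IsGradientLike.levelProj_smul_eq_of_level`,
  elsewhere both take the junk value `x`);
* `ZFrame.flowLift_eq`, `ZFrame.flowLift_eq_g_lamLift` — hence the transported functions
  `φ̄ = φ ∘ π` agree, and at hitting points `φ̄ = g ∘ λ̂`;
* `ZFrame.mlineDeriv_U`, `ZFrame.mlineDeriv_U_pos_iff` — `U.ξ(F) = ρ_U · ζ(F)`;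
* `ZFrame.exists_flow_eq_fl` — a point of the `ζ`-trajectory is a point of the `U`-trajectory.

## References

* J. Milnor, *Lectures on the h-cobordism theorem* (1965), Def. 3.1, proof of Thm. 3.4
  (PDF pp. 12–13), Thm. 4.1. [MilnorHCobordism1965]
* D. Gay, R. Kirby, *Trisecting 4-manifolds*, Geom. Topol. 20 (2016), §4, Lemma 14. [GayKirby2016]
-/

open scoped Manifold ContDiff Topology
open Set Function Filter

noncomputable section

universe u

namespace Literature.Topology.FourManifolds

open Flow

/-- Local notation: `𝔼 n` is the model Euclidean space `EuclideanSpace ℝ (Fin n)`. -/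
local notation "𝔼 " n:arg => EuclideanSpace ℝ (Fin n)

variable {X : Type u} [TopologicalSpace X] [T2Space X] [CompactSpace X] [ChartedSpace (𝔼 4) X]
  [IsManifold (𝓡 4) ∞ X]

namespace BiCollar

variable (B : BiCollar X)

/-- **A gradient-like frame of the bi-collar**: a smooth gradient-like field `ζ` for the Morse
function `f` of which the unit field is a positive multiple, `U.ξ = ρ_U • ζ` (Milnor's
normalisation `ρ_U = 1/ζ(f)` on a band). [cite: MilnorHCobordism1965, Def. 3.1 and proof of Thm. 3.4] -/
structure ZFrame where
  /-- The un-normalised gradient-like field. -/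
  ζ : Π x : X, TangentSpace (𝓡 4) x
  /-- It is smooth. -/
  hζ : ContMDiff (𝓡 4) (𝓡 4).tangent ∞ fun x => (⟨x, ζ x⟩ : TangentBundle (𝓡 4) X)
  /-- It is gradient-like for `f`. -/
  hgl : IsGradientLike (𝓡 4) B.f ζ
  /-- `f` is Morse and `U.ξ` is gradient-like. -/
  Fr : B.MorseFrame
  /-- The speed factor. -/
  ρU : X → ℝ
  /-- The speed factor is continuous. -/
  continuous_ρU : Continuous ρU
  /-- The speed factor is positive. -/
  ρU_pos : ∀ x, 0 < ρU x
  /-- `U.ξ = ρ_U • ζ`. -/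
  U_eq : ∀ x, B.U.ξ x = ρU x • ζ x

namespace ZFrame

variable {B} (Z : B.ZFrame)

omit [T2Space X] [CompactSpace X] in
/-- `f` is Morse. [folklore] -/
theorem isMorse (Z : B.ZFrame) : IsMorse (𝓡 4) B.f := Z.Fr.isMorse

/-- **Hitting the level is the same for `U.ξ` and for `ζ`.** [cite: MilnorHCobordism1965, proof of Thm. 3.4 (PDF pp. 12–13)] -/
theorem hit_iff (x : X) : B.Hit x ↔ Hits (flowθ Z.hζ) B.f B.a x :=
  hits_flowθ_smul_iff Z.hζ B.U.contMDiff Z.U_eq Z.continuous_ρU Z.ρU_pos x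

/-- **The landing map is the projection along `ζ`** (at hitting points). [cite: MilnorHCobordism1965, Thm. 4.1 (PDF p. 22)] -/
theorem lam_eq {x : X} (hx : B.Hit x) : B.lam x = levelProj Z.hζ B.f B.a x :=
  Z.hgl.levelProj_smul_eq_of_level Z.hζ B.U.contMDiff Z.U_eq Z.continuous_ρU Z.ρU_pos
    Z.Fr.isMorse (fun _ hy => B.not_isMCriticalPt_of_apply_eq_a hy) ((Z.hit_iff x).1 hx)

/-- **The projections onto the level along `U.ξ` and along `ζ` agree everywhere** (at hitting
points by the time change; elsewhere both are the junk value `x`). [cite: MilnorHCobordism1965, Thm. 4.1 (PDF p. 22)] -/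
theorem levelProj_eq (x : X) : levelProj B.U.contMDiff B.f B.a x = levelProj Z.hζ B.f B.a x := by
  by_cases hx : B.Hit x
  · exact Z.lam_eq hx
  · have hx' : ¬ Hits (flowθ Z.hζ) B.f B.a x := fun h => hx ((Z.hit_iff x).2 h)
    have h1 : hittingTime (flowθ B.U.contMDiff) B.f B.a x = 0 := by
      rw [hittingTime, dif_neg (show ¬ Hits (flowθ B.U.contMDiff) B.f B.a x from hx)]
    have h2 : hittingTime (flowθ Z.hζ) B.f B.a x = 0 := by
      rw [hittingTime, dif_neg hx']
    show flow B.U.contMDiff x (hittingTime (flowθ B.U.contMDiff) B.f B.a x) =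
      flow Z.hζ x (hittingTime (flowθ Z.hζ) B.f B.a x)
    rw [h1, h2, flow_zero, flow_zero]

/-- The projections as functions agree. [folklore] -/
theorem levelProj_eq' : levelProj B.U.contMDiff B.f B.a = levelProj Z.hζ B.f B.a :=
  funext Z.levelProj_eq

/-- The landing point, read along `ζ`. [cite: MilnorHCobordism1965, Thm. 4.1 (PDF p. 22)] -/
theorem incl_lamLift_eq {x : X} (hx : B.Hit x) :
    RegularLevel.incl B.hf (B.lamLift x) = levelProj Z.hζ B.f B.a x := by
  rw [B.incl_lamLift hx, Z.lam_eq hx]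

/-- **The transported functions agree**: `φ ∘ π_U = φ ∘ π_ζ`. [cite: MilnorHCobordism1965, Thm. 4.1 (PDF p. 22)] -/
theorem flowLift_eq (φ : B.Y → ℝ) : flowLift B.U.contMDiff B.hf φ = flowLift Z.hζ B.hf φ := by
  funext x
  simp only [flowLift, Z.levelProj_eq x]

/-- For a hitting point, `φ̄ = g ∘ λ̂` (along `U.ξ`). [folklore] -/
theorem _root_.Literature.Topology.FourManifolds.BiCollar.flowLift_eq_g_lamLift {z : X} (hz : B.Hit z) :
    flowLift B.U.contMDiff B.hf B.g z = B.g (B.lamLift z) := by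
  have h1 : B.f (B.lam z) = B.a := B.f_lam hz
  have h2 : B.f (levelProj B.U.contMDiff B.f B.a z) = B.a := h1
  simp only [flowLift, BiCollar.lamLift, dif_pos h1, dif_pos h2]
  rfl

/-- **For a hitting point, `φ̄ = g ∘ λ̂` along `ζ`.** [cite: MilnorHCobordism1965, Thm. 4.1 (PDF p. 22)] -/
theorem flowLift_eq_g_lamLift {z : X} (hz : B.Hit z) : flowLift Z.hζ B.hf B.g z = B.g (B.lamLift z) := by
  rw [← Z.flowLift_eq]; exact B.flowLift_eq_g_lamLift hz

omit [T2Space X] [CompactSpace X] in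
/-- **`U.ξ(F) = ρ_U · ζ(F)`.** [folklore] -/
theorem mlineDeriv_U (F : X → ℝ) (x : X) :
    mlineDeriv (𝓡 4) F x (B.U.ξ x) = Z.ρU x * mlineDeriv (𝓡 4) F x (Z.ζ x) := by
  rw [Z.U_eq x, mlineDeriv_smul]

omit [T2Space X] [CompactSpace X] in
/-- `U.ξ(F) > 0` iff `ζ(F) > 0`. [folklore] -/
theorem mlineDeriv_U_pos_iff (F : X → ℝ) (x : X) :
    0 < mlineDeriv (𝓡 4) F x (B.U.ξ x) ↔ 0 < mlineDeriv (𝓡 4) F x (Z.ζ x) := by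
  rw [Z.mlineDeriv_U]
  exact mul_pos_iff_of_pos_left (Z.ρU_pos x)

/-- **A point of the `ζ`-trajectory of `x` is a point of its `U`-trajectory.** [cite: MilnorHCobordism1965, proof of Thm. 3.4 (PDF pp. 12–13)] -/
theorem exists_flow_eq_fl (x : X) (t : ℝ) : ∃ s, flow Z.hζ x t = B.U.fl x s := by
  obtain ⟨e, -, -, he⟩ := exists_orderIso_flow_smul_eq Z.hζ B.U.contMDiff Z.U_eq Z.continuous_ρU Z.ρU_pos x
  refine ⟨e.symm t, ?_⟩
  show flow Z.hζ x t = flow B.U.contMDiff x (e.symm t)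
  rw [he, OrderIso.apply_symm_apply]

/-- **A point of the `U`-trajectory of `x` is a point of its `ζ`-trajectory.** [cite: MilnorHCobordism1965, proof of Thm. 3.4 (PDF pp. 12–13)] -/
theorem exists_fl_eq_flow (x : X) (s : ℝ) : ∃ t, B.U.fl x s = flow Z.hζ x t := by
  obtain ⟨e, -, -, he⟩ := exists_orderIso_flow_smul_eq Z.hζ B.U.contMDiff Z.U_eq Z.continuous_ρU Z.ρU_pos x
  exact ⟨e s, he s⟩

end ZFrame

end BiCollar

end Literature.Topology.FourManifolds

end
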